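import Summits.Ventures.PercRepro.RankLevelSetHallLevelOne

/-!
# PercRepro — WEIGHTED SPLITS AT A RANK LEVEL, AND THE FLAT-EXCESS RULE (night-1, gen 23; dossier §35.7)

A WEIGHTED SPLIT: every set `S ∈ Y` of rank `t` divides one unit among the members `Z ⊆ S` in proportion to a weight
`w S Z > 0`; the member `Z` receives `splitRecvLevel w p q t Z = Σ_{S ∈ Y, r S = t, Z ⊆ S} w S Z / W(S)`,
`W(S) = Σ_{Z' ⊆ S member} w S Z'`.  THE EXCHANGE OF SUMS (`hallUp_level_of_split`, as `hallUp_level_of_ruleQLevel`):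
if every member receives at least `c` then every subfamily `𝒜` of members has at least `c·#𝒜` rank-`t` UP-neighbours —
for ANY positive weights.  Rule Q is the constant weight `1`.

THE FLAT-EXCESS RULE (`flatExcessW`): for a set `S` let `Fat(S)` be the rank-`q` flats `G` with `#(S ∩ G) ≥ q + 1` and
`β_G = #(S ∩ G) − q + 1`; the weight of a member `Z ⊆ S` is `1 + Σ_{G ∈ Fat(S)} (β_G^{#(Z ∩ G)} − 1)`.  With no fat flat it
is Rule Q.  `FlatExcessUp M p q t` (a `Prop`, NOT asserted): every member receives at least `C(p+q,t)/C(p+q,q)` at the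
level `t`; census (night-1 g23, own exact code, dossier §35.7): every matroid on ≤ 9 elements at the tight layer at every
level (min ratio exactly 1), the model family `T_{q+k}(U_{q,F} ⊕ free)` for `q ≤ 64`, `k ≤ 7`, all `m`, all levels by exact
type receipts (42,840 instances), the cells where Rule Q fails, two-fat-flat models, direct sums, random binary matroids:
0 failures.  `levelHallUp_of_flatExcessUp`: the rule pays the level-wise form (`LevelHallUpC025` = night-2's
`ShadowC025Level`) at that level for every subfamily; `FlatExcessC025` — the conjecture at every level of every cell
at the tight layer.  Axioms: standard.
-/

namespace PercRepro

open Set Matroid Finset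

variable {α : Type} (M : Matroid α) [M.Finite]

open scoped Classical in
/-- The members of the cell inside `S`, as a finset. -/
noncomputable def membersIn (p q : ℕ) (S : Set α) : Finset (Set α) :=
  (cellMembers_finite M p q).toFinset.filter (fun Z => Z ⊆ S)

open scoped Classical in
/-- Membership in `membersIn`. -/
lemma mem_membersIn {p q : ℕ} {S Z : Set α} : Z ∈ membersIn M p q S ↔ Z ∈ cellMembers M p q ∧ Z ⊆ S := by
  unfold membersIn
  rw [Finset.mem_filter, (cellMembers_finite M p q).mem_toFinset]

/-- The total weight of `S` under the weight system `w`. -/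
noncomputable def splitTotal (w : Set α → Set α → ℚ) (p q : ℕ) (S : Set α) : ℚ :=
  ∑ Z ∈ membersIn M p q S, w S Z

open scoped Classical in
/-- **The receipt of `Z` at the rank level `t` under the weighted split `w`**:
`Σ_{S ∈ Y, r S = t, Z ⊆ S} w S Z / W(S)`. -/
noncomputable def splitRecvLevel (w : Set α → Set α → ℚ) (p q t : ℕ) (Z : Set α) : ℚ :=
  ∑ S ∈ (cellY_finite M p q).toFinset.filter (fun S => M.eRk S = (t : ℕ∞)),
    Set.indicator {S : Set α | Z ⊆ S} (fun S => w S Z / splitTotal M w p q S) S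

/-- **The exchange of sums for a weighted split**: positive weights, every member receiving at least `c` at the level
`t` ⇒ every subfamily `𝒜` of members has at least `c·#𝒜` rank-`t` UP-neighbours. -/
theorem hallUp_level_of_split (w : Set α → Set α → ℚ) (p q t : ℕ)
    (hpos : ∀ S Z, Z ∈ cellMembers M p q → Z ⊆ S → 0 < w S Z) (c : ℚ)
    (h : ∀ Z ∈ cellMembers M p q, c ≤ splitRecvLevel M w p q t Z)
    (𝒜 : Set (Set α)) (h𝒜 : 𝒜 ⊆ cellMembers M p q) :
    c * (𝒜.ncard : ℚ) ≤ ({S ∈ upNbhd M p q 𝒜 | M.eRk S = (t : ℕ∞)}.ncard : ℚ) := by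
  classical
  have h𝒜fin : 𝒜.Finite := (cellMembers_finite M p q).subset h𝒜
  set 𝒜f : Finset (Set α) := h𝒜fin.toFinset with h𝒜f
  set Yf : Finset (Set α) := (cellY_finite M p q).toFinset.filter (fun S => M.eRk S = (t : ℕ∞)) with hYf
  have h𝒜card : (𝒜.ncard : ℚ) = (𝒜f.card : ℚ) := by
    rw [h𝒜f, ncard_eq_toFinset_card _ h𝒜fin]
  have h1 : c * (𝒜f.card : ℚ) ≤ ∑ Z ∈ 𝒜f, splitRecvLevel M w p q t Z := by
    rw [mul_comm, ← nsmul_eq_mul, ← Finset.sum_const]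
    refine Finset.sum_le_sum (fun Z hZ => ?_)
    rw [h𝒜f, h𝒜fin.mem_toFinset] at hZ
    exact h Z (h𝒜 hZ)
  have h2 : ∑ Z ∈ 𝒜f, splitRecvLevel M w p q t Z =
      ∑ S ∈ Yf, (∑ Z ∈ 𝒜f.filter (fun Z => Z ⊆ S), w S Z) / splitTotal M w p q S := by
    unfold splitRecvLevel
    rw [← hYf, Finset.sum_comm]
    refine Finset.sum_congr rfl (fun S _ => ?_)
    simp only [Set.indicator_apply, Set.mem_setOf_eq]
    rw [Finset.sum_ite, Finset.sum_const_zero, add_zero, Finset.sum_div]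
  have h3 : ∀ S ∈ Yf, (∑ Z ∈ 𝒜f.filter (fun Z => Z ⊆ S), w S Z) / splitTotal M w p q S ≤
      (if ∃ Z ∈ 𝒜, Z ⊆ S then (1 : ℚ) else 0) := by
    intro S _
    by_cases hex : ∃ Z ∈ 𝒜, Z ⊆ S
    · rw [if_pos hex]
      have hsub : 𝒜f.filter (fun Z => Z ⊆ S) ⊆ membersIn M p q S := by
        intro Z hZ
        rw [Finset.mem_filter, h𝒜f, h𝒜fin.mem_toFinset] at hZ
        rw [mem_membersIn]
        exact ⟨h𝒜 hZ.1, hZ.2⟩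
      have hnn : ∀ Z ∈ membersIn M p q S, 0 ≤ w S Z := by
        intro Z hZ
        rw [mem_membersIn] at hZ
        exact (hpos S Z hZ.1 hZ.2).le
      have hle : ∑ Z ∈ 𝒜f.filter (fun Z => Z ⊆ S), w S Z ≤ splitTotal M w p q S := by
        unfold splitTotal
        exact Finset.sum_le_sum_of_subset_of_nonneg hsub (fun Z hZ _ => hnn Z hZ)
      have hWpos : 0 < splitTotal M w p q S := by
        obtain ⟨Z, hZ, hZS⟩ := hex
        unfold splitTotal
        refine Finset.sum_pos' hnn ⟨Z, ?_, hpos S Z (h𝒜 hZ) hZS⟩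
        rw [mem_membersIn]
        exact ⟨h𝒜 hZ, hZS⟩
      rw [div_le_one hWpos]
      exact hle
    · rw [if_neg hex]
      have hzero : 𝒜f.filter (fun Z => Z ⊆ S) = ∅ := by
        rw [Finset.filter_eq_empty_iff]
        intro Z hZ hZS
        rw [h𝒜f, h𝒜fin.mem_toFinset] at hZ
        exact hex ⟨Z, hZ, hZS⟩
      rw [hzero, Finset.sum_empty, zero_div]
  have h4 : ∑ S ∈ Yf, (if ∃ Z ∈ 𝒜, Z ⊆ S then (1 : ℚ) else 0) =
      ({S ∈ upNbhd M p q 𝒜 | M.eRk S = (t : ℕ∞)}.ncard : ℚ) := by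
    rw [Finset.sum_ite, Finset.sum_const_zero, add_zero, Finset.sum_const, nsmul_eq_mul, mul_one]
    have hU : {S ∈ upNbhd M p q 𝒜 | M.eRk S = (t : ℕ∞)} =
        ((Yf.filter (fun S => ∃ Z ∈ 𝒜, Z ⊆ S) : Finset (Set α)) : Set (Set α)) := by
      ext S
      rw [Finset.coe_filter, hYf, Set.mem_setOf_eq, Set.mem_setOf_eq, Finset.mem_filter,
        (cellY_finite M p q).mem_toFinset]
      constructor
      · rintro ⟨⟨hSE, hq, hp, hex⟩, hr⟩
        exact ⟨⟨⟨hSE, hq, hp⟩, hr⟩, hex⟩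
      · rintro ⟨⟨⟨hSE, hq, hp⟩, hr⟩, hex⟩
        exact ⟨⟨hSE, hq, hp, hex⟩, hr⟩
    rw [hU, ncard_coe_finset]
  calc c * (𝒜.ncard : ℚ) = c * (𝒜f.card : ℚ) := by rw [h𝒜card]
    _ ≤ ∑ Z ∈ 𝒜f, splitRecvLevel M w p q t Z := h1
    _ = ∑ S ∈ Yf, (∑ Z ∈ 𝒜f.filter (fun Z => Z ⊆ S), w S Z) / splitTotal M w p q S := h2
    _ ≤ ∑ S ∈ Yf, (if ∃ Z ∈ 𝒜, Z ⊆ S then (1 : ℚ) else 0) := Finset.sum_le_sum h3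
    _ = ({S ∈ upNbhd M p q 𝒜 | M.eRk S = (t : ℕ∞)}.ncard : ℚ) := h4

/-! ## The flat-excess rule -/

/-- The rank-`q` flats of `M` are finitely many. -/
lemma flatsQ_finite (q : ℕ) : {G : Set α | G ⊆ M.E ∧ M.IsFlat G ∧ M.eRk G = (q : ℕ∞)}.Finite :=
  M.ground_finite.finite_subsets.subset (fun _ h => h.1)

/-- **The fat flats of `S`**: the rank-`q` flats `G` with `#(S ∩ G) ≥ q + 1`. -/
noncomputable def fatFlats (q : ℕ) (S : Set α) : Finset (Set α) :=
  (flatsQ_finite M q).toFinset.filter (fun G => q + 1 ≤ (S ∩ G).ncard)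

/-- **The flat-excess weight** of `Z` in `S`: `1 + Σ_{G fat in S} ((#(S ∩ G) − q + 1)^{#(Z ∩ G)} − 1)`. -/
noncomputable def flatExcessW (q : ℕ) (S Z : Set α) : ℚ :=
  1 + ∑ G ∈ fatFlats M q S, ((((S ∩ G).ncard - q + 1 : ℕ) : ℚ) ^ (Z ∩ G).ncard - 1)

/-- The flat-excess weight is at least `1`. -/
lemma one_le_flatExcessW (q : ℕ) (S Z : Set α) : 1 ≤ flatExcessW M q S Z := by
  unfold flatExcessW
  have : 0 ≤ ∑ G ∈ fatFlats M q S, ((((S ∩ G).ncard - q + 1 : ℕ) : ℚ) ^ (Z ∩ G).ncard - 1) := by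
    refine Finset.sum_nonneg (fun G hG => ?_)
    rw [sub_nonneg]
    have hb : (1 : ℚ) ≤ (((S ∩ G).ncard - q + 1 : ℕ) : ℚ) := by
      have : 1 ≤ (S ∩ G).ncard - q + 1 := by omega
      exact_mod_cast this
    exact one_le_pow₀ hb
  linarith

/-- **The flat-excess rule pays the level `t`** (a `Prop`, NOT asserted): every member of the cell receives at least
`C(p+q,t)/C(p+q,q)` at the rank level `t` under the flat-excess split. -/
def FlatExcessUp (p q t : ℕ) : Prop :=
  ∀ Z ∈ cellMembers M p q,
    ((p + q).choose t : ℚ) / ((p + q).choose q : ℚ) ≤ splitRecvLevel M (flatExcessW M q) p q t Z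

/-- **The flat-excess rule pays the level-wise form**: `FlatExcessUp M p q t` gives, for every subfamily `𝒜` of
members, `C(p+q,t)·#𝒜 ≤ C(p+q,q)·#{S ∈ upNbhd 𝒜 : r S = t}`. -/
theorem levelHallUp_of_flatExcessUp (p q t : ℕ) (hpq : q + 2 ≤ p) (h : FlatExcessUp M p q t)
    (𝒜 : Set (Set α)) (h𝒜 : 𝒜 ⊆ cellMembers M p q) :
    ((p + q).choose t : ℚ) * (𝒜.ncard : ℚ) ≤
      ((p + q).choose q : ℚ) * ({S ∈ upNbhd M p q 𝒜 | M.eRk S = (t : ℕ∞)}.ncard : ℚ) := by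
  have hH := hallUp_level_of_split M (flatExcessW M q) p q t
    (fun S Z _ _ => lt_of_lt_of_le one_pos (one_le_flatExcessW M q S Z))
    (((p + q).choose t : ℚ) / ((p + q).choose q : ℚ)) h 𝒜 h𝒜
  have hchoose : (0 : ℚ) < ((p + q).choose q : ℚ) := by
    exact_mod_cast Nat.choose_pos (by omega)
  rw [div_mul_eq_mul_div, div_le_iff₀ hchoose] at hH
  linarith

omit [M.Finite] in
/-- **THE FLAT-EXCESS CONJECTURE** (a `Prop`, NOT asserted): the flat-excess rule pays every level of every cell at the
tight layer of every finite matroid. -/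
def FlatExcessC025 : Prop :=
  ∀ {α : Type} (M : Matroid α) [M.Finite] (p q t : ℕ), M.E.ncard = p + q → q + 2 ≤ p → q < t → t < p →
    FlatExcessUp M p q t

/-- **The flat-excess conjecture gives the level-wise form at the tight layer** (`LevelHallUpC025` restricted to
`#E = p + q`; with `levelHallUp_iff_shadowC025Level`, night-2's `ShadowC025Level` at the tight layer). -/
theorem levelHallUp_tight_of_flatExcessC025 (h : FlatExcessC025) {p q t : ℕ} (hE : M.E.ncard = p + q)
    (hpq : q + 2 ≤ p) (hqt : q < t) (htp : t < p) (𝒜 : Set (Set α)) (h𝒜 : 𝒜 ⊆ cellMembers M p q) :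
    ((p + q).choose t : ℚ) * (𝒜.ncard : ℚ) ≤
      ((p + q).choose q : ℚ) * ({S ∈ upNbhd M p q 𝒜 | M.eRk S = (t : ℕ∞)}.ncard : ℚ) :=
  levelHallUp_of_flatExcessUp M p q t hpq (h M p q t hE hpq hqt htp) 𝒜 h𝒜

end PercRepro
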